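import Literature.AnabelianGeometry.EtaleTheta.LogDivisorModelTateTowerThetaTwistLevelActionMod
import Literature.AnabelianGeometry.EtaleTheta.LogDivisorModelTateTowerKummerTwistTower
import Literature.AnabelianGeometry.EtaleTheta.LogDivisorModelTateTowerKummerTwistCompatRShear

/-!
# [EtTh] Def. 3.3 (iii), Tate tower v3 piece 2c: the SIGN-FREE (β) Kummer TOWER of the `Ÿ`-skeleton WITH CUSPS AND THETA over the
# compatible shear-semidirect group «GRP₃′» `Ẑ(1)³ ⋊ (Ẑˣ × ℤ_γ)` — a `LogDivisorTower`, every field a definition or a theorem (class (b))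

S. Mochizuki, *The étale theta function …*, Publ. RIMS **45** (2009) [MochizukiEtTh2009], §1 p.13, Prop. 1.4 (ii) p.22, Def. 3.1 /
Prop. 3.2 p.70, Def. 3.3 (i)(c)/(ii)/(iii) pp.72–74 [cite: MochizukiEtTh2009, Def 3.3 (iii) p.73].

CLASS (b) MODEL / NON-VACUITY WITNESS (abc-iut cell, layer L2; seat abc-iut-L2-t3 (gen 7); file 2 of the 2c plan
`HOME/staging/L2/L2-t3/g7/2c/DESIGN-2c-ThetaTowerGrp3.md`; design (β) RULED by abc-iut-L2-lead gen 7 R922).  Consumed BY NAME, nothing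
restated: abc-iut-L1-t6's «GRP₃′» `TateTowerKummerTwistRShear.Grp 3 thetaShear`, its compatible subgroup `Compat 3 thetaShear ≅
Ẑ(1)³ ⋊ (Ẑˣ × ℤ_γ)`, `levelsC`, `closureC` (p481663, p482446); abc-iut-L2-d2's moduli `N n = (n+1)!`, roots of unity `MuN n = μ_{N n}`,
reduction `castN`, inclusion `upAdd` / `up` with `upAdd_castHom` (p478618 `…KummerTwistTower`); this seat's levels
`TateTowerThetaTwist.model μ` (p480037), transitions `resFn ι e` (p482960), level actions at a quotient modulus `levelActionMod`
(`…ThetaTwistLevelActionMod`), `resFn_kummerAut` / `resFn_translAut` (p482960 / p484463).  Exactly abc-iut-L2-d2's `towerC` with the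
chain-only levels replaced by the `Ÿ`-levels and THREE Kummer classes acting:
* `actC₃ n` — `Compat 3 thetaShear` acting on level `n` = `model (MuN n)` through `levelActFnMod n (N n)` (index-`n` classes and
  character READ MODULO `N n`; translations sign-free);
* `resFnC₃ h := resFn (upAdd h) (eN i j)` (roots of unity included, root exponents × ramification index), `resDIV := (−)^{eN i j}`;
* equivariance ON `Compat`: (A) `upAdd_levelChar` (characters), (B) `upAdd_levelKum` (classes: `ι(κ_i) = e • κ_j`), hence
  `resFnC₃_levelActFnMod`; `Δ_n` trivial at level `n` (`levelActFnMod_eq_one_of_mem_closureC`);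
* **`towerC₃ : LogDivisorTower (Compat 3 thetaShear) (levelsC 3 thetaShear)`** + `nonempty_towerC₃`.
DEVIATION OF RECORD (design (β), R922): the torsion sign `(−1)^a` of [EtTh] Prop. 1.4 (ii) (p.248: `Θ̈(q^{a/2} Ü) = (−1)^a q^{−a²/2}
Ü^{−2a} Θ̈(Ü)`; `Θ̈(−Ü) = −Θ̈(Ü)`) is NOT carried by the level translations (`translAut 0`); print carries signs inside `O^×_K̈ · η̈^Θ`
(Prop. 1.4 (iii)) and the `(l·ℤ × μ₂)`-orbit classes `η̈^{Θ, l·ℤ×μ₂}` (Def. 2.7 p.267; Cor. 2.8 (i)); everything this tower is for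
(log-divisors, the root law, temperedness, Kummer classes modulo torsion at the §5 junction) is sign-blind; the sign-faithful
alternative («GRP₃″», booked) is quantified by `translAut_eq_kummerAut_translAut` (p485381).  HONEST LABEL: a class-(b) combinatorial
DESIGN model (finite groups of roots of unity adjoined level-wise to the `Ÿ`-skeleton), NOT the tempered tower of a Tate curve; the
root law / temperedness / the tf over `B^temp(Compat)⁰` are the sequels (files 3–4 of the plan); nothing here bears on [IUTchIII]
Cor. 3.12; no side taken; typed ≠ proved.
-/

noncomputable section

namespace Literature.AnabelianGeometry.EtaleTheta

open CategoryTheory Function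

namespace LogDivisorModel

namespace TateTowerThetaTwist

open TateTowerTheta
open TateTowerKummerTwist (M one_lt_M Cst res resC N coe_N N_dvd_M N_dvd_N eN N_mul_eN eN_self eN_mul_eN eN_pos MuN castN castN_res
  upAdd upAdd_castHom upAdd_refl upAdd_trans upAdd_injective)
open TateTowerKummerTwistR (KumAdd Kum)
open TateTowerKummerTwistRShear (Grp act red thetaShear thetaShearMat compat Compat closureC mem_closureC_iff levelsC
  coord_eq_zero_of_mem_closureC right_eq_one_of_mem_closureC resC_right_eq res_coord_eq)

/-! ## §1 The level-`n` action of `Compat 3 thetaShear` (classes and character read modulo `N n`) -/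

/-- The level-`n` Galois action of the compatible group on `model (MuN n)`: «GRP₃′» at modulus `N n ∣ M n`, restricted to `Compat`.
[cite: MochizukiEtTh2009, Def 3.3 (iii) p.73] -/
def actC₃ (n : ℕ) : (model (MuN n)).GaloisAction (Compat 3 thetaShear) :=
  (levelActionMod n (N n) (N_dvd_M n)).comap (compat 3 thetaShear).subtype

/-- `actC₃` on functions. [cite: MochizukiEtTh2009, Def 3.3 (iii) p.73] -/
theorem actC₃_actFn_apply (n : ℕ) (g : Compat 3 thetaShear) (f : Fn (MuN n)) :
    (actC₃ n).actFn g f = levelActFnMod n (N n) (N_dvd_M n) (g : Grp 3 thetaShear) f := rfl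

/-- `actC₃` on log-divisors: the skeleton's shift by the translation component. [cite: MochizukiEtTh2009, Def 3.3 (iii) p.73] -/
theorem actC₃_actDIV_apply (n : ℕ) (g : Compat 3 thetaShear) (d : (model (MuN n)).DIV) :
    (actC₃ n).actDIV g d = TateTowerTheta.baseAction.actDIV (g : Grp 3 thetaShear).right.2 d := rfl

/-- **`Δ_n ∩ Compat` acts trivially on the level-`n` functions** (`n = 0`: `μ_1`; `n = m+1`: `k_{m+1} ≡ k_m = 0 (mod M_m = N_{m+1})`,
all three classes; the translation and the character components are trivial on `Δ_n`). [cite: MochizukiEtTh2009, Def 3.3 (i) p.72] -/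
theorem levelActFnMod_eq_one_of_mem_closureC {n : ℕ} {g : Compat 3 thetaShear} (hg : g ∈ closureC 3 thetaShear n) :
    levelActFnMod n (N n) (N_dvd_M n) (g : Grp 3 thetaShear) = 1 := by
  refine levelActFnMod_eq_one n (N n) (N_dvd_M n) (right_eq_one_of_mem_closureC 3 thetaShear hg) fun a => ?_
  rcases n with _ | m
  · haveI : Subsingleton (ZMod (N 0)) := ZMod.subsingleton_iff.2 rfl
    exact Subsingleton.elim _ _
  · -- `castHom : ℤ/M_{m+1} → ℤ/N_{m+1}` IS abc-iut-L1-t6's `res : ℤ/M_{m+1} → ℤ/M_m` (ring maps out of `ℤ/M` are unique)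
    have hk := coord_eq_zero_of_mem_closureC 3 thetaShear hg m (Nat.lt_succ_self m)
    have hc := res_coord_eq 3 thetaShear g (show m ≤ m + 1 from Nat.le_succ m) a
    rw [hk, Pi.zero_apply] at hc
    exact (RingHom.congr_fun (Subsingleton.elim (ZMod.castHom (N_dvd_M (m + 1)) (ZMod (N (m + 1))))
      (res (show m ≤ m + 1 from Nat.le_succ m))) _).trans hc

/-! ## §2 The transitions and their equivariance on `Compat` -/

/-- The transition on functions (`i ≤ j`): `(ζ, ϖ̈_i^c Ü_i^k Θ̈_i^t) ↦ (up ζ, ϖ̈_j^{ec} Ü_j^{ek} Θ̈_j^{et})`, `e = eN i j`.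
[cite: MochizukiEtTh2009, Def 3.3 (iii) p.73] -/
def resFnC₃ {i j : ℕ} (h : i ≤ j) : Fn (MuN i) →* Fn (MuN j) := resFn (upAdd h) (eN i j)

/-- `resFnC₃` IS `resFn (upAdd h) (eN i j)`. [cite: MochizukiEtTh2009, Def 3.3 (iii) p.73] -/
theorem resFnC₃_eq {i j : ℕ} (h : i ≤ j) : resFnC₃ h = resFn (upAdd h) (eN i j) := rfl

/-- **(A) the characters are compatible with the inclusion of roots of unity on `Compat`**: `ι(χ_i(c) z) = χ_j(c) ι(z)`
(`c_j ≡ c_i`). [cite: MochizukiEtTh2009, §1 p.13] -/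
theorem upAdd_levelChar {i j : ℕ} (h : i ≤ j) (g : Compat 3 thetaShear) (z : ZMod (N i)) :
    upAdd h (levelCharModAdd i (N i) (N_dvd_M i) (g : Grp 3 thetaShear).right.1 z) =
      levelCharModAdd j (N j) (N_dvd_M j) (g : Grp 3 thetaShear).right.1 (upAdd h z) := by
  rw [levelCharModAdd_apply, levelCharModAdd_apply]
  obtain ⟨y, hy⟩ := ZMod.castHom_surjective (N_dvd_N h) z
  have hc : ZMod.castHom (N_dvd_M i) (ZMod (N i)) ((g : Grp 3 thetaShear).right.1 i : ZMod (M i)) =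
      ZMod.castHom (N_dvd_N h) (ZMod (N i)) (ZMod.castHom (N_dvd_M j) (ZMod (N j)) ((g : Grp 3 thetaShear).right.1 j : ZMod (M j))) := by
    rw [← resC_right_eq 3 thetaShear g h]
    exact castN_res h _
  rw [← hy, hc, ← map_mul, upAdd_castHom, upAdd_castHom, mul_left_comm]

/-- **(B) the Kummer classes are compatible with the inclusion on `Compat`**: `ι(κ_i) = e • κ_j` for the classes read at levels
`i ≤ j` (`k_j ≡ k_i`). [cite: MochizukiEtTh2009, Def 3.3 (ii) p.73] -/
theorem upAdd_levelKum {i j : ℕ} (h : i ≤ j) (g : Compat 3 thetaShear) (a : Fin 3) :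
    upAdd h (ZMod.castHom (N_dvd_M i) (ZMod (N i)) (Multiplicative.toAdd (g : Grp 3 thetaShear).left i a)) =
      (eN i j : ℤ) • ZMod.castHom (N_dvd_M j) (ZMod (N j)) (Multiplicative.toAdd (g : Grp 3 thetaShear).left j a) := by
  rw [← res_coord_eq 3 thetaShear g h a]
  change upAdd h (castN i (res h _)) = _
  rw [castN_res, upAdd_castHom, zsmul_eq_mul, Int.cast_natCast]
  rfl

/-- Reduction modulo `N` commutes with the character (a constant automorphism) along the transition: `resFn ∘ C_i = C_j ∘ resFn`.
[cite: MochizukiEtTh2009, §1 p.13] -/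
theorem resFn_constAut {B B' : Type} [AddCommGroup B] [AddCommGroup B'] (ι : B →+ B') (e : ℕ) (φ : B ≃+ B) (φ' : B' ≃+ B')
    (hφ : ∀ z, ι (φ z) = φ' (ι z)) (x : Fn (Multiplicative B)) :
    resFn ι e (constAut φ x) = constAut φ' (resFn ι e x) :=
  Prod.ext (by rw [resFn_apply, constAut_fst, constAut_fst, resFn_apply]; exact congrArg Multiplicative.ofAdd (hφ _)) rfl

/-- **EQUIVARIANCE of the transitions on `Compat`**: `resFnC₃ (g ·_i f) = g ·_j (resFnC₃ f)` — (A) + (B) + the sign-free translations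
commute with every transition. [cite: MochizukiEtTh2009, Def 3.3 (iii) p.73] -/
theorem resFnC₃_levelActFnMod {i j : ℕ} (h : i ≤ j) (g : Compat 3 thetaShear) (f : Fn (MuN i)) :
    resFnC₃ h (levelActFnMod i (N i) (N_dvd_M i) (g : Grp 3 thetaShear) f) =
      levelActFnMod j (N j) (N_dvd_M j) (g : Grp 3 thetaShear) (resFnC₃ h f) := by
  rw [levelActFnMod_apply, levelActFnMod_apply, MulAut.mul_apply, MulAut.mul_apply, MulAut.mul_apply, MulAut.mul_apply,
    kumActMod_apply, kumActMod_apply, ← toMultiplicative_levelCharModAdd, ← toMultiplicative_levelCharModAdd, constAction_apply,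
    constAction_apply, translAction_apply, translAction_apply, resFnC₃_eq]
  rw [resFn_kummerAut (upAdd h) (eN i j) (fun a => upAdd_levelKum h g a), resFn_constAut (upAdd h) (eN i j) _ _ (upAdd_levelChar h g),
    resFn_translAut (upAdd h) (eN i j) (show upAdd h (0 : ZMod (N i)) = (eN i j : ℤ) • (0 : ZMod (N j)) by rw [map_zero, smul_zero])]

/-- `i ≤ j` from `Δ_j ⊆ Δ_i` inside `Compat` (abc-iut-L1-t6). [cite: MochizukiEtTh2009, Def 3.3 (i) p.72] -/
theorem le_of_levelsC₃ {i j : ℕ} (h : (levelsC 3 thetaShear).closure j ≤ (levelsC 3 thetaShear).closure i) : i ≤ j :=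
  TateTowerKummerTwistRShear.levelsC_le_of_closure_le 3 thetaShear h

/-- `resExp 1 = id`. [cite: MochizukiEtTh2009, Def 3.3 (iii) p.74] -/
theorem resExp_one (f : Exp) : resExp 1 f = f :=
  ext_exp rfl (by rw [eC_resExp, Nat.cast_one, one_mul]) (by rw [eU_resExp, Nat.cast_one, one_mul])
    (by rw [eT_resExp, Nat.cast_one, one_mul])

/-- `resExp (e e') = resExp e' ∘ resExp e`. [cite: MochizukiEtTh2009, Def 3.3 (iii) p.74] -/
theorem resExp_mul (e e' : ℕ) (f : Exp) : resExp (e * e') f = resExp e' (resExp e f) :=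
  ext_exp rfl (by rw [eC_resExp, eC_resExp, eC_resExp, Nat.cast_mul]; ring)
    (by rw [eU_resExp, eU_resExp, eU_resExp, Nat.cast_mul]; ring) (by rw [eT_resExp, eT_resExp, eT_resExp, Nat.cast_mul]; ring)

/-! ## §3 The tower -/

/-- **The sign-free Kummer tower of the `Ÿ`-skeleton over `Compat 3 thetaShear`** (every field a definition or a theorem): level `n` =
`TateTowerThetaTwist.model μ_{(n+1)!}` (`μ × μ₂ × ⟨ϖ̈_n⟩ × ⟨Ü_n⟩ × ⟨Θ̈_n⟩`, cusps ⊔ components as log-divisors), «GRP₃′» acting through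
`levelActFnMod n (N n)` (three Kummer classes, character, shear-translations), `Δ_n` trivial at level `n`, transitions = inclusion of
roots of unity × ramification index, equivariant exactly by the compatibilities defining `Compat`. [cite: MochizukiEtTh2009, Def 3.3 (iii) p.73] -/
def towerC₃ : LogDivisorTower (Compat 3 thetaShear) (levelsC 3 thetaShear) where
  Z n := model (MuN n)
  cuspLaws n := TateTowerThetaTwist.cuspLaws (MuN n)
  act n := actC₃ n
  act_closure_fn n g hg := by
    change levelActFnMod n (N n) (N_dvd_M n) (g : Grp 3 thetaShear) = 1
    exact levelActFnMod_eq_one_of_mem_closureC hg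
  act_closure_div n g hg := by
    change TateTowerTheta.baseAction.actDIV (g : Grp 3 thetaShear).right.2 = 1
    rw [right_eq_one_of_mem_closureC 3 thetaShear hg, Prod.snd_one, map_one]
  resFn {_ _} h := resFnC₃ (le_of_levelsC₃ h)
  resDIV {i j} _ := powMonoidHom (eN i j)
  resFn_refl i f := by
    change resFn (upAdd le_rfl) (eN i i) f = f
    refine Prod.ext (Multiplicative.toAdd.injective ?_) (Multiplicative.toAdd.injective ?_)
    · show upAdd le_rfl (Multiplicative.toAdd f.1) = Multiplicative.toAdd f.1
      exact upAdd_refl i _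
    · show resExp (eN i i) (Multiplicative.toAdd f.2) = Multiplicative.toAdd f.2
      rw [eN_self, resExp_one]
      rfl
  resFn_trans {i j k} hij hjk f := by
    change resFn (upAdd ((le_of_levelsC₃ hij).trans (le_of_levelsC₃ hjk))) (eN i k) f =
      resFn (upAdd (le_of_levelsC₃ hjk)) (eN j k) (resFn (upAdd (le_of_levelsC₃ hij)) (eN i j) f)
    refine Prod.ext (Multiplicative.toAdd.injective ?_) (Multiplicative.toAdd.injective ?_)
    · show upAdd ((le_of_levelsC₃ hij).trans (le_of_levelsC₃ hjk)) (Multiplicative.toAdd f.1) =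
        upAdd (le_of_levelsC₃ hjk) (upAdd (le_of_levelsC₃ hij) (Multiplicative.toAdd f.1))
      rw [upAdd_trans (le_of_levelsC₃ hij) (le_of_levelsC₃ hjk)]
    · show resExp (eN i k) (Multiplicative.toAdd f.2) = resExp (eN j k) (resExp (eN i j) (Multiplicative.toAdd f.2))
      rw [← resExp_mul, eN_mul_eN (le_of_levelsC₃ hij) (le_of_levelsC₃ hjk)]
  resDIV_refl i d := by
    change d ^ eN i i = d
    rw [eN_self, pow_one]
  resDIV_trans {i j k} hij hjk d := by
    change d ^ eN i k = (d ^ eN i j) ^ eN j k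
    rw [← pow_mul, eN_mul_eN (le_of_levelsC₃ hij) (le_of_levelsC₃ hjk)]
  resFn_injective {i j} h := resFn_injective (upAdd (le_of_levelsC₃ h)) (upAdd_injective (le_of_levelsC₃ h)) (eN_pos (le_of_levelsC₃ h)).ne'
  resFn_mem_logMero _ _ _ := trivial
  resFn_mem_const {i j} h f hf := by
    have hk : eU (Multiplicative.toAdd f.2) = 0 ∧ eT (Multiplicative.toAdd f.2) = 0 := hf
    show eU (resExp (eN i j) (Multiplicative.toAdd f.2)) = 0 ∧ eT (resExp (eN i j) (Multiplicative.toAdd f.2)) = 0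
    rw [eU_resExp, eT_resExp, hk.1, hk.2, mul_zero]
    exact ⟨rfl, rfl⟩
  resFn_mem_intConst {i j} h f hf := by
    have hk : 0 ≤ eC (Multiplicative.toAdd f.2) ∧ eU (Multiplicative.toAdd f.2) = 0 ∧ eT (Multiplicative.toAdd f.2) = 0 := hf
    show 0 ≤ eC (resExp (eN i j) (Multiplicative.toAdd f.2)) ∧ eU (resExp (eN i j) (Multiplicative.toAdd f.2)) = 0 ∧
      eT (resExp (eN i j) (Multiplicative.toAdd f.2)) = 0
    rw [eC_resExp, eU_resExp, eT_resExp, hk.2.1, hk.2.2, mul_zero]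
    exact ⟨mul_nonneg (Int.natCast_nonneg _) hk.1, rfl, rfl⟩
  resDIV_mem_DIVplus {i j} _ d hd := Submonoid.pow_mem _ hd _
  resDIV_mem_Div _ _ _ := trivial
  resDIV_mem_nonCuspidal {i j} _ d hd := Subgroup.pow_mem _ hd _
  resDIV_mem_cuspidal {i j} _ d hd := Subgroup.pow_mem _ hd _
  divisor_resFn {i j} h f := Multiplicative.toAdd.injective (funext fun x =>
    (toAdd_divisor_resFn (upAdd (le_of_levelsC₃ h)) (eN i j) f x).trans (nsmul_eq_mul _ _).symm)
  resFn_act {i j} h g f := resFnC₃_levelActFnMod (le_of_levelsC₃ h) g f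
  resDIV_act {i j} _ g d := (map_pow (shiftDIV (Multiplicative.toAdd (g : Grp 3 thetaShear).right.2)) d _).symm

/-- **A multi-level inhabitant of the `LogDivisorTower` interface over «GRP₃′» with cusps, theta roots and recorded roots of unity.**
[cite: MochizukiEtTh2009, Def 3.3 (iii) p.73] -/
theorem nonempty_towerC₃ : Nonempty (LogDivisorTower (Compat 3 thetaShear) (levelsC 3 thetaShear)) := ⟨towerC₃⟩

/-- The levels of the tower are the `Ÿ`-levels `model (MuN n)`. [cite: MochizukiEtTh2009, Def 3.3 (iii) p.73] -/
theorem towerC₃_Z (n : ℕ) : towerC₃.Z n = model (MuN n) := rfl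

/-- The level actions of the tower are `actC₃`. [cite: MochizukiEtTh2009, Def 3.3 (iii) p.73] -/
theorem towerC₃_act (n : ℕ) : towerC₃.act n = actC₃ n := rfl

/-! ## §4 Content: the theta class MOVES the root `Θ̈_n` at every level `n ≥ 1` -/

/-- **The compatible Kummer element of `Θ̈`-class `1 ∈ Ẑ(1)`** (all indices, third coordinate), trivial constants, no translation.
[cite: MochizukiEtTh2009, Def 3.3 (ii) p.73] -/
def kumThetaC : Compat 3 thetaShear :=
  ⟨SemidirectProduct.inl (Multiplicative.ofAdd fun n => Pi.single (2 : Fin 3) (1 : ZMod (M n))), by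
    refine ⟨fun i j h => ?_, fun i j h => ?_⟩
    · rw [SemidirectProduct.left_inl, toAdd_ofAdd]
      ext a
      rw [TateTowerKummerTwistR.resK_apply]
      by_cases ha : a = 2
      · subst ha; rw [Pi.single_eq_same, Pi.single_eq_same, map_one]
      · rw [Pi.single_eq_of_ne ha, Pi.single_eq_of_ne ha, map_zero]
    · rw [SemidirectProduct.right_inl, Prod.fst_one, Pi.one_apply, Pi.one_apply, map_one]⟩

/-- **At every level `n ≥ 1` the theta class multiplies the root `Θ̈_n` by `ζ_{N n} ≠ 1`** — the third Kummer class of «GRP₃′» ACTS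
on the tower (non-vacuity of the `Θ̈`-coordinate). [cite: MochizukiEtTh2009, §1 p.13] -/
theorem actFn_kumThetaC_theta (n : ℕ) :
    (towerC₃.act n).actFn kumThetaC (theta (MuN n)) = (Multiplicative.ofAdd (1 : ZMod (N n)), TateTowerTheta.theta) := by
  change levelActFnMod n (N n) (N_dvd_M n) (SemidirectProduct.inl _) (theta (MuN n)) = _
  rw [levelActFnMod_kum_theta, toAdd_ofAdd, Pi.single_eq_same, map_one]

/-- `ζ_{N n} ≠ 1` in `μ_{N n}` for `n ≥ 1` (`N n = (n+1)! ≥ 2`), so `Θ̈_n` is MOVED. [cite: MochizukiEtTh2009, §1 p.13] -/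
theorem actFn_kumThetaC_theta_ne {n : ℕ} (hn : 1 ≤ n) : (towerC₃.act n).actFn kumThetaC (theta (MuN n)) ≠ theta (MuN n) := by
  rw [actFn_kumThetaC_theta]
  intro h
  have h1 : (Multiplicative.ofAdd (1 : ZMod (N n))) = 1 := congrArg Prod.fst h
  have h2 : (1 : ZMod (N n)) = 0 := ofAdd_eq_one.mp h1
  haveI : Fact (1 < ((N n : ℕ+) : ℕ)) := ⟨by
    rw [coe_N]
    calc 1 < 2 := by norm_num
      _ = Nat.factorial 2 := rfl
      _ ≤ Nat.factorial (n + 1) := Nat.factorial_le (by omega)⟩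
  exact one_ne_zero h2

end TateTowerThetaTwist

end LogDivisorModel

end Literature.AnabelianGeometry.EtaleTheta

end
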